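import Mathlib
import Summits.ValiantsHypothesis.ValiantsHypothesis.Theorems.LacunarySymmetroidMatrixDescartesDescartesSharpOnSupport
import Summits.ValiantsHypothesis.ValiantsHypothesis.Theorems.KPlusLogSqLawWeakLiftingTowerGraftRankOneGraft

/-!
# Tower graft line — CORNER-GRAFT PHANTOMS: no additive corner law in INSTANCE currency, at any steepness

Calibration file for the line `Cruxes/WeakLifting/Lines/tower_graft.lean` (crux `WeakLifting` = stmt-ValiantsHypothesis-19561;
S4b `stub_graftLawCorner`, T1/T2 of the memo `Lines/tower_graft-S5.md` §3).  NO stub is claimed.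

The corner graft `h = det (G + X^D·E₀₀) = A + X^D·E` (`A = det G`, `E = det G₀₀`) of record was LOCATED to obey an «additive law»
`Z₊(h) ≤ Z₊(A) + Z₊(E) + 1` (kit j318899, 24 000/24 000 at `D ≥ 4n`; excess ≤ 3 found at `D = lin`), and the T1 disc instrument's
overhead at `D = lin` was read as «additive O(m) + 2·Z₊(E)» (kit j321241, m = 2…8 at K = 3, 4).  THIS FILE: in INSTANCE currency
(the actual counts `Z₊(A)`, `Z₊(E)` of the pencil at hand) NO such law exists, for ANY additive constant and at EVERY steepness `D`:

`exists_cornerGraft_phantoms` — for every injective support `d` with `K ≥ 2` letters, every `l₀` and every `D ≥ d l₀` there are symmetric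
`2 × 2` letters with `det G < 0` and `det G₀₀ > 0` on `(0, ∞)` (so `Z₊(A) = Z₊(E) = 0`) and `Z₊(det (G + X^D·E₀₀)) ≥ 2K − 3`.
Letters: `G = [[−½·X^{d l₀}, r], [r, ε·q]]`, `r` a `K`-nomial on `d` vanishing at `2, 4, …, 2K − 2` (`DescartesSharp.exists_fewnomial_vanishing`),
`q = Σₗ X^{d l}`, `ε > 0` small; then `h = ε·q·(X^D − ½X^{d l₀}) − r²` is positive at the `K − 1` zeros of `r` and negative at `K − 1` interleaved
points where `r ≠ 0` — an IVT certificate with `2K − 2` points.  The `2K − 3` crossings are PHANTOMS: born from the `K − 1` near-axis complex root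
pairs of `A = −½εX^{d l₀}q − r²` (one pair per real zero of `r`), with no positive zero of `A` or `E` to charge them to.

`exists_tower_cornerGraft_phantoms` / `not_instanceAdditive_cornerLaw` — hence for every `c` and every `D₀` there is a genuine `2`-tower `d`
(`dₗ = 4^l`), a tower-top corner exponent `D ≥ D₀` (`2·dₗ < D`) and symmetric letters with `Z₊(A) = Z₊(E) = 0` and `c < Z₊(h)`: the overhead of
any theorem-side T1 at `D = lin` (or steeper) is `≥ 2K − 4` at `m = 2` — it is NOT `O(m)`; it must be charged to the CLASS budget `B` (here
`2K − 3 ≤ B − 1` by `DescartesSharp.le_of_posRootLawOn`, so nothing is claimed against S4b, whose right-hand side `2^C·B + 2^C` pays it at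
`C = 0`).  This is the memo's T2 remark («sums of squares put ≈ m(K−1) zeros near the axis — within budget») in kernel and corner-graft form.

HONEST FRAMING: a calibration (lower bound) for the T1/T2 programme; nothing on S4/S4b/S5/S5ᴸ, TowerB, `WeakLifting`, Conjecture B,
`MatrixDescartes` (18050) or `VP ≠ VNP`.  Def-free.  Seat: prover val-sym-lift-p2 g19, `--supports stmt-ValiantsHypothesis-19561`.
-/

-- `Summit.ValiantsHypothesis.ValiantsHypothesis.…` repeats a component by the D-0017 layout
-- (single-conjunct summit), which the `dupNamespace` linter flags; the name is mandated.
set_option linter.dupNamespace false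

namespace Summit.ValiantsHypothesis.ValiantsHypothesis.Theorems.KPlusLogSqLaw.TowerGraft

open Polynomial Matrix Finset
open scoped BigOperators Polynomial
open Summit.ValiantsHypothesis.ValiantsHypothesis.Theorems.LacunarySymmetroidMatrixDescartes (PosRootLawOn)
open Summit.ValiantsHypothesis.ValiantsHypothesis.Theorems.LacunarySymmetroidMatrixDescartes.DescartesSharp
  (exists_fewnomial_vanishing fewnomial_ne_zero le_of_posRootLawOn)
open Summit.ValiantsHypothesis.ValiantsHypothesis.Theorems.SymmetroidDescartes
  (eval_det_pencil le_card_posRoots_of_alternating)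

section CornerPhantoms

variable {K : ℕ}

/-- a real polynomial that is `< 0` on `(0, ∞)` has no positive root. [folklore] -/
theorem card_posRoots_eq_zero_of_eval_neg (P : ℝ[X]) (h : ∀ t : ℝ, 0 < t → P.eval t < 0) :
    (P.roots.toFinset.filter (fun t => 0 < t)).card = 0 := by
  refine Finset.card_eq_zero.mpr (Finset.filter_eq_empty_iff.mpr fun t ht hpos => ?_)
  have hr := (Polynomial.mem_roots'.mp (Multiset.mem_toFinset.mp ht)).2
  have := h t hpos
  rw [Polynomial.IsRoot.def] at hr
  linarith

/-- a real polynomial that is `> 0` on `(0, ∞)` has no positive root. [folklore] -/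
theorem card_posRoots_eq_zero_of_eval_pos (P : ℝ[X]) (h : ∀ t : ℝ, 0 < t → 0 < P.eval t) :
    (P.roots.toFinset.filter (fun t => 0 < t)).card = 0 := by
  refine Finset.card_eq_zero.mpr (Finset.filter_eq_empty_iff.mpr fun t ht hpos => ?_)
  have hr := (Polynomial.mem_roots'.mp (Multiset.mem_toFinset.mp ht)).2
  have := h t hpos
  rw [Polynomial.IsRoot.def] at hr
  linarith

/-- the `(0,0)`-minor pencil of a `2 × 2` pencil is the pencil of the `(1,1)` entries. [folklore] -/
theorem submatrix_succ_pencil_two (d : Fin K → ℕ) (S : Fin K → Matrix (Fin 2) (Fin 2) ℝ) :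
    (∑ l, (X : ℝ[X]) ^ d l • (S l).map C).submatrix Fin.succ Fin.succ =
      ∑ l, (X : ℝ[X]) ^ d l • ((S l).submatrix Fin.succ Fin.succ).map C := by
  refine Matrix.ext fun i j => ?_
  simp [Matrix.submatrix_apply, Matrix.sum_apply, Matrix.smul_apply, Matrix.map_apply]

/-- **CORNER-GRAFT PHANTOMS (m = 2, every K ≥ 2, every injective support, every steepness).**  See the module docstring:
symmetric `2 × 2` letters on `d` with `det G < 0 < det G₀₀` on `(0,∞)` and `Z₊(det (G + X^D·E₀₀)) ≥ 2K − 3`. [this work] -/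
theorem exists_cornerGraft_phantoms (hK : 2 ≤ K) {d : Fin K → ℕ} (hd : Function.Injective d)
    (l₀ : Fin K) {D : ℕ} (hD : d l₀ ≤ D) :
    ∃ S : Fin K → Matrix (Fin 2) (Fin 2) ℝ, (∀ l, (S l).IsSymm) ∧
      (∀ t : ℝ, 0 < t → ((∑ l, (X : ℝ[X]) ^ d l • (S l).map C).det).eval t < 0) ∧
      (∀ t : ℝ, 0 < t →
        0 < (((∑ l, (X : ℝ[X]) ^ d l • (S l).map C).submatrix Fin.succ Fin.succ).det).eval t) ∧
      2 * K - 3 ≤ ((((∑ l, (X : ℝ[X]) ^ d l • (S l).map C) +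
          (X : ℝ[X]) ^ D • Matrix.single (0 : Fin 2) (0 : Fin 2) (1 : ℝ[X])).det).roots.toFinset.filter
        (fun t => 0 < t)).card := by
  classical
  -- (1) the off-diagonal fewnomial `r`, vanishing at `ρ j = 2(j+1)`, `j < K − 1`
  set ρ : Fin (K - 1) → ℝ := fun j => 2 * ((j : ℕ) : ℝ) + 2 with hρ
  obtain ⟨c, hc0, hc⟩ := exists_fewnomial_vanishing (by omega) d ρ
  set r : ℝ[X] := ∑ l, (X : ℝ[X]) ^ d l * C (c l) with hr
  have hr0 : r ≠ 0 := fewnomial_ne_zero hd hc0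
  have hr_eval : ∀ t : ℝ, r.eval t = ∑ l, t ^ d l * c l := fun t => by
    simp only [hr, eval_finsetSum, eval_mul, eval_pow, eval_X, eval_C]
  have hr_root : ∀ k : ℕ, k < K - 1 → r.eval (2 * (k : ℝ) + 2) = 0 := fun k hk => by
    rw [hr_eval]; exact hc ⟨k, hk⟩
  -- (2) interleaved points `τ k ∈ (2k+1, 2k+3/2)` off the (finite) root set of `r`
  have hτex : ∀ k : ℕ, ∃ τ : ℝ, (2 * (k : ℝ) + 1 < τ ∧ τ < 2 * (k : ℝ) + 3 / 2) ∧ r.eval τ ≠ 0 := by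
    intro k
    obtain ⟨τ, hτ, hτr⟩ :=
      (Set.Ioo_infinite (show 2 * (k : ℝ) + 1 < 2 * (k : ℝ) + 3 / 2 by linarith)).exists_notMem_finset
        r.roots.toFinset
    refine ⟨τ, hτ, fun h0 => hτr ?_⟩
    exact Multiset.mem_toFinset.mpr ((Polynomial.mem_roots hr0).mpr h0)
  choose τ hτI hτr using hτex
  have hτ_one : ∀ k, 1 ≤ τ k := fun k => by
    have h1 := (hτI k).1
    have h2 : (0 : ℝ) ≤ k := Nat.cast_nonneg k
    linarith
  have hτ_pos : ∀ k, 0 < τ k := fun k => by linarith [hτ_one k]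
  -- (3) the diagonal fewnomial `q = Σ X^{d l}` (as a real function) and the scale `ε`
  set qf : ℝ → ℝ := fun t => ∑ l, t ^ d l with hqf
  have hqf_pos : ∀ t : ℝ, 0 < t → 0 < qf t := fun t ht =>
    Finset.sum_pos (fun l _ => pow_pos ht _) ⟨l₀, Finset.mem_univ _⟩
  have harc : ∀ t : ℝ, 1 ≤ t → 0 < t ^ D - t ^ d l₀ / 2 := fun t ht => by
    have h1 : t ^ d l₀ ≤ t ^ D := pow_le_pow_right₀ ht hD
    have h2 : 0 < t ^ d l₀ := pow_pos (by linarith) _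
    linarith
  set Mf : ℕ → ℝ := fun k => qf (τ k) * (τ k ^ D - τ k ^ d l₀ / 2) with hMf
  set Rf : ℕ → ℝ := fun k => r.eval (τ k) * r.eval (τ k) with hRf
  have hMf_pos : ∀ k, 0 < Mf k := fun k => mul_pos (hqf_pos _ (hτ_pos k)) (harc _ (hτ_one k))
  have hRf_pos : ∀ k, 0 < Rf k := fun k => by
    simp only [hRf]
    rcases lt_or_gt_of_ne (hτr k) with h | h
    · exact mul_pos_of_neg_of_neg h h
    · exact mul_pos h h
  set Sq : ℝ := ∑ k ∈ Finset.range (K - 1), Mf k / Rf k with hSq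
  have hSq_nonneg : 0 ≤ Sq := Finset.sum_nonneg fun k _ => div_nonneg (hMf_pos k).le (hRf_pos k).le
  set ε : ℝ := 1 / (1 + Sq) with hε
  have hε_pos : 0 < ε := by rw [hε]; positivity
  have hεM : ∀ k, k < K - 1 → ε * Mf k < Rf k := by
    intro k hk
    have hle : Mf k / Rf k ≤ Sq :=
      Finset.single_le_sum (f := fun j => Mf j / Rf j) (fun j _ => div_nonneg (hMf_pos j).le (hRf_pos j).le)
        (Finset.mem_range.mpr hk)
    have hRne : Rf k ≠ 0 := (hRf_pos k).ne'
    have h1 : Rf k * (Mf k / Rf k) = Mf k := by field_simp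
    rw [hε, div_mul_eq_mul_div, one_mul, div_lt_iff₀ (by positivity)]
    calc Mf k = Rf k * (Mf k / Rf k) := h1.symm
      _ < Rf k * (1 + Sq) := mul_lt_mul_of_pos_left (by linarith) (hRf_pos k)
  -- (4) the letters
  set S : Fin K → Matrix (Fin 2) (Fin 2) ℝ := fun l => !![(if l = l₀ then -(1 / 2 : ℝ) else 0), c l; c l, ε] with hS
  have hS_symm : ∀ l, (S l).IsSymm := fun l => Matrix.IsSymm.ext fun i j => by
    fin_cases i <;> fin_cases j <;> simp [hS]
  set G : Matrix (Fin 2) (Fin 2) ℝ[X] := ∑ l, (X : ℝ[X]) ^ d l • (S l).map C with hG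
  -- the real pencil at `t`
  have hP : ∀ t : ℝ, (∑ l, t ^ d l • S l) = !![-(t ^ d l₀) / 2, r.eval t; r.eval t, ε * qf t] := by
    intro t
    ext i j
    rw [Matrix.sum_apply]
    fin_cases i <;> fin_cases j
    · simp [hS, Matrix.smul_apply, mul_ite, Finset.sum_ite_eq']
      ring
    · simp [hS, Matrix.smul_apply, hr_eval]
    · simp [hS, Matrix.smul_apply, hr_eval]
    · simp [hS, Matrix.smul_apply, hqf, Finset.mul_sum, mul_comm]
  have hA_eval : ∀ t : ℝ, G.det.eval t = -(t ^ d l₀) / 2 * (ε * qf t) - r.eval t * r.eval t := by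
    intro t
    rw [hG, eval_det_pencil, hP, Matrix.det_fin_two_of]
  -- the `(0,0)`-minor
  have hP1 : ∀ t : ℝ, (∑ l, t ^ d l • (S l).submatrix Fin.succ Fin.succ) = !![ε * qf t] := by
    intro t
    ext i j
    rw [Matrix.sum_apply]
    fin_cases i; fin_cases j
    simp [hS, Matrix.smul_apply, Matrix.submatrix_apply, hqf, Finset.mul_sum, mul_comm]
  have hE_eval : ∀ t : ℝ, (G.submatrix Fin.succ Fin.succ).det.eval t = ε * qf t := by
    intro t
    rw [hG, submatrix_succ_pencil_two, eval_det_pencil, hP1, Matrix.det_fin_one]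
    simp
  -- the corner graft
  have hh_eq : (G + (X : ℝ[X]) ^ D • Matrix.single (0 : Fin 2) (0 : Fin 2) (1 : ℝ[X])).det =
      G.det + (X : ℝ[X]) ^ D * (G.submatrix Fin.succ Fin.succ).det :=
    det_add_smul_single_zero (m := 1) G ((X : ℝ[X]) ^ D)
  obtain ⟨h, hh⟩ : ∃ h : ℝ[X], h = (G + (X : ℝ[X]) ^ D • Matrix.single (0 : Fin 2) (0 : Fin 2) (1 : ℝ[X])).det :=
    ⟨_, rfl⟩
  have hh_eval : ∀ t : ℝ, h.eval t = ε * (qf t * (t ^ D - t ^ d l₀ / 2)) - r.eval t * r.eval t := by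
    intro t
    rw [hh, hh_eq, eval_add, eval_mul, eval_pow, eval_X, hA_eval, hE_eval]
    ring
  -- signs at the certificate points
  have hh_tau : ∀ k, k < K - 1 → h.eval (τ k) < 0 := by
    intro k hk
    rw [hh_eval]
    have := hεM k hk
    simp only [hMf, hRf] at this
    linarith
  have hh_rho : ∀ k, k < K - 1 → 0 < h.eval (2 * (k : ℝ) + 2) := by
    intro k hk
    rw [hh_eval, hr_root k hk, mul_zero, sub_zero]
    have h2 : (0 : ℝ) ≤ k := Nat.cast_nonneg k
    exact mul_pos hε_pos (mul_pos (hqf_pos _ (by linarith)) (harc _ (by linarith)))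
  -- (5) the alternation certificate: `τ 0 < 2 < τ 1 < 4 < ⋯ < τ (K−2) < 2K − 2`
  set f : ℕ → ℝ := fun n => if n % 2 = 0 then τ (n / 2) else (n : ℝ) + 1 with hf
  have hf_even : ∀ n : ℕ, n % 2 = 0 → f n = τ (n / 2) := fun n hn => by simp only [hf, if_pos hn]
  have hf_odd : ∀ n : ℕ, ¬ n % 2 = 0 → f n = ((n : ℕ) : ℝ) + 1 := fun n hn => by simp only [hf, if_neg hn]
  have hf_lb : ∀ n : ℕ, ((n : ℕ) : ℝ) + 1 ≤ f n := by
    intro n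
    by_cases hn : n % 2 = 0
    · rw [hf_even n hn]
      have h1 := (hτI (n / 2)).1
      have h2 : (((n / 2 : ℕ) : ℕ) : ℝ) * 2 = ((n : ℕ) : ℝ) := by
        have : (n / 2) * 2 = n := by omega
        exact_mod_cast this
      linarith
    · rw [hf_odd n hn]
  have hf_ub : ∀ n : ℕ, f n < ((n : ℕ) : ℝ) + 2 := by
    intro n
    by_cases hn : n % 2 = 0
    · rw [hf_even n hn]
      have h1 := (hτI (n / 2)).2
      have h2 : (((n / 2 : ℕ) : ℕ) : ℝ) * 2 = ((n : ℕ) : ℝ) := by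
        have : (n / 2) * 2 = n := by omega
        exact_mod_cast this
      linarith
    · rw [hf_odd n hn]; linarith
  have hf_pos : ∀ n : ℕ, 0 < f n := fun n => by
    have h1 := hf_lb n
    have h2 : (0 : ℝ) ≤ ((n : ℕ) : ℝ) := Nat.cast_nonneg n
    linarith
  have hf_mono : StrictMono f := by
    intro i j hij
    have h1 : ((i : ℕ) : ℝ) + 2 ≤ ((j : ℕ) : ℝ) + 1 := by
      have h3 : i + 1 ≤ j := hij
      have h4 : (((i + 1 : ℕ) : ℕ) : ℝ) ≤ ((j : ℕ) : ℝ) := by exact_mod_cast h3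
      push_cast at h4; linarith
    linarith [hf_ub i, hf_lb j]
  -- adjacent points have opposite signs, up to index `2K − 4`
  have hf_alt : ∀ n : ℕ, n + 1 ≤ 2 * K - 3 → h.eval (f n) * h.eval (f (n + 1)) < 0 := by
    intro n hn
    by_cases hpar : n % 2 = 0
    · -- `n = 2k`: `f n = τ k`, `f (n+1) = 2k + 2`
      have hk : n / 2 < K - 1 := by omega
      have e2 : f (n + 1) = 2 * (((n / 2 : ℕ) : ℕ) : ℝ) + 2 := by
        rw [hf_odd (n + 1) (by omega)]
        have : (((n / 2 : ℕ) : ℕ) : ℝ) * 2 = ((n : ℕ) : ℝ) := by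
          have : (n / 2) * 2 = n := by omega
          exact_mod_cast this
        push_cast; linarith
      rw [hf_even n hpar, e2]
      exact mul_neg_of_neg_of_pos (hh_tau _ hk) (hh_rho _ hk)
    · -- `n = 2k+1`: `f n = 2k + 2`, `f (n+1) = τ (k+1)`
      have hk : n / 2 < K - 1 := by omega
      have hk1 : (n + 1) / 2 < K - 1 := by omega
      have e1 : f n = 2 * (((n / 2 : ℕ) : ℕ) : ℝ) + 2 := by
        rw [hf_odd n hpar]
        have : (((n / 2 : ℕ) : ℕ) : ℝ) * 2 + 1 = ((n : ℕ) : ℝ) := by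
          have : (n / 2) * 2 + 1 = n := by omega
          exact_mod_cast this
        linarith
      rw [e1, hf_even (n + 1) (by omega)]
      exact mul_neg_of_pos_of_neg (hh_rho _ hk) (hh_tau _ hk1)
  -- (6) count
  refine ⟨S, hS_symm, fun t ht => ?_, fun t ht => ?_, ?_⟩
  · rw [hA_eval]
    have h1 : 0 < t ^ d l₀ := pow_pos ht _
    have h2 : 0 < ε * qf t := mul_pos hε_pos (hqf_pos t ht)
    nlinarith [mul_self_nonneg (r.eval t)]
  · rw [hE_eval]; exact mul_pos hε_pos (hqf_pos t ht)
  · have hcnt := le_card_posRoots_of_alternating h (2 * K - 3) (fun i => f (i : ℕ)) (fun i j hij => hf_mono hij)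
      (fun i => hf_pos i) (fun j => by
        have e1 : ((Fin.castSucc j : Fin (2 * K - 3 + 1)) : ℕ) = (j : ℕ) := rfl
        have e2 : ((Fin.succ j : Fin (2 * K - 3 + 1)) : ℕ) = (j : ℕ) + 1 := rfl
        simp only [e1, e2]
        exact hf_alt j (by omega))
    simpa [hh] using hcnt

/-- cardinality form of `exists_cornerGraft_phantoms`: `Z₊(det G) = 0`, `Z₊(det G₀₀) = 0`, `Z₊(det (G + X^D·E₀₀)) ≥ 2K − 3`. [this work] -/
theorem exists_cornerGraft_phantoms_card (hK : 2 ≤ K) {d : Fin K → ℕ} (hd : Function.Injective d)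
    (l₀ : Fin K) {D : ℕ} (hD : d l₀ ≤ D) :
    ∃ S : Fin K → Matrix (Fin 2) (Fin 2) ℝ, (∀ l, (S l).IsSymm) ∧
      (((∑ l, (X : ℝ[X]) ^ d l • (S l).map C).det).roots.toFinset.filter (fun t => 0 < t)).card = 0 ∧
      ((((∑ l, (X : ℝ[X]) ^ d l • (S l).map C).submatrix Fin.succ Fin.succ).det).roots.toFinset.filter
        (fun t => 0 < t)).card = 0 ∧
      2 * K - 3 ≤ ((((∑ l, (X : ℝ[X]) ^ d l • (S l).map C) +
          (X : ℝ[X]) ^ D • Matrix.single (0 : Fin 2) (0 : Fin 2) (1 : ℝ[X])).det).roots.toFinset.filter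
        (fun t => 0 < t)).card := by
  obtain ⟨S, hS, hA, hE, hh⟩ := exists_cornerGraft_phantoms hK hd l₀ hD
  exact ⟨S, hS, card_posRoots_eq_zero_of_eval_neg _ hA, card_posRoots_eq_zero_of_eval_pos _ hE, hh⟩

/-- `dₗ = 4^l` is a `2`-tower (indeed a `3`-tower). [folklore] -/
theorem two_mul_four_pow_lt_of_lt {n : ℕ} {l l' : Fin n} (h : l < l') : 2 * 4 ^ (l : ℕ) < 4 ^ (l' : ℕ) := by
  have h1 : (l : ℕ) + 1 ≤ l' := h
  have h2 : 0 < 4 ^ (l : ℕ) := Nat.pow_pos (by norm_num)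
  calc 2 * 4 ^ (l : ℕ) < 4 ^ ((l : ℕ) + 1) := by rw [pow_succ]; omega
    _ ≤ 4 ^ (l' : ℕ) := Nat.pow_le_pow_right (by norm_num) h1

/-- **THE PHANTOM COUNT IS UNBOUNDED ON GENUINE 2-TOWERS AT TOWER-TOP STEEPNESS.**  For every `c` and every `D₀` there are a `2`-tower `d`
(`dₗ = 4^l`, `K = c + 2` letters), a corner exponent `D ≥ D₀` above the tower (`2·dₗ < D`) and symmetric `2 × 2` letters with
`Z₊(det G) = 0`, `Z₊(det G₀₀) = 0` and `Z₊(det (G + X^D·E₀₀)) > c`. [this work] -/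
theorem exists_tower_cornerGraft_phantoms (c D₀ : ℕ) :
    ∃ (K : ℕ) (d : Fin K → ℕ) (D : ℕ) (S : Fin K → Matrix (Fin 2) (Fin 2) ℝ),
      (∀ l l' : Fin K, l < l' → 2 * d l < d l') ∧ (∀ l, 2 * d l < D) ∧ D₀ ≤ D ∧ (∀ l, (S l).IsSymm) ∧
      (((∑ l, (X : ℝ[X]) ^ d l • (S l).map C).det).roots.toFinset.filter (fun t => 0 < t)).card = 0 ∧
      ((((∑ l, (X : ℝ[X]) ^ d l • (S l).map C).submatrix Fin.succ Fin.succ).det).roots.toFinset.filter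
        (fun t => 0 < t)).card = 0 ∧
      c < ((((∑ l, (X : ℝ[X]) ^ d l • (S l).map C) +
          (X : ℝ[X]) ^ D • Matrix.single (0 : Fin 2) (0 : Fin 2) (1 : ℝ[X])).det).roots.toFinset.filter
        (fun t => 0 < t)).card := by
  set K := c + 2 with hK
  set d : Fin K → ℕ := fun l => 4 ^ (l : ℕ) with hd
  set D := D₀ + 2 * 4 ^ (c + 1) + 1 with hDdef
  have hd_inj : Function.Injective d := fun l l' h =>
    Fin.ext (Nat.pow_right_injective (by norm_num : 2 ≤ 4) (by simpa [hd] using h : (4 : ℕ) ^ (l : ℕ) = 4 ^ (l' : ℕ)))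
  have hl₀ : d ⟨0, by omega⟩ ≤ D := by simp [hd, hDdef]
  obtain ⟨S, hS, hA, hE, hh⟩ := exists_cornerGraft_phantoms_card (K := K) (by omega) hd_inj ⟨0, by omega⟩ hl₀
  refine ⟨K, d, D, S, fun l l' hll' => two_mul_four_pow_lt_of_lt hll', fun l => ?_, by omega, hS, hA, hE, ?_⟩
  · have h1 : 4 ^ (l : ℕ) ≤ 4 ^ (c + 1) := Nat.pow_le_pow_right (by norm_num) (by omega)
    simp only [hd, hDdef]
    omega
  · omega

/-- **NO ADDITIVE CORNER-GRAFT LAW IN INSTANCE CURRENCY (kill template, m = 2).**  There is no constant `c` with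
`Z₊(det (G + X^D·E₀₀)) ≤ Z₊(det G) + Z₊(det G₀₀) + c` for all symmetric `2 × 2` pencils `G` on `2`-towers with the corner above the tower —
not even at arbitrarily large prescribed steepness.  (The class-currency law S4b, `≤ 2^C·B + 2^C`, is untouched: here `Z₊ ≤ B + 1`.) [this work] -/
theorem not_instanceAdditive_cornerLaw :
    ¬ ∃ c : ℕ, ∀ (K D : ℕ) (d : Fin K → ℕ) (S : Fin K → Matrix (Fin 2) (Fin 2) ℝ),
      (∀ l l' : Fin K, l < l' → 2 * d l < d l') → (∀ l, 2 * d l < D) → (∀ l, (S l).IsSymm) →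
      ((((∑ l, (X : ℝ[X]) ^ d l • (S l).map C) +
          (X : ℝ[X]) ^ D • Matrix.single (0 : Fin 2) (0 : Fin 2) (1 : ℝ[X])).det).roots.toFinset.filter
        (fun t => 0 < t)).card ≤
      (((∑ l, (X : ℝ[X]) ^ d l • (S l).map C).det).roots.toFinset.filter (fun t => 0 < t)).card +
      ((((∑ l, (X : ℝ[X]) ^ d l • (S l).map C).submatrix Fin.succ Fin.succ).det).roots.toFinset.filter
        (fun t => 0 < t)).card + c := by
  rintro ⟨c, hc⟩
  obtain ⟨K, d, D, S, hd, hD, -, hS, hA, hE, hh⟩ := exists_tower_cornerGraft_phantoms c 0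
  have := hc K D d S hd hD hS
  rw [hA, hE] at this
  omega

end CornerPhantoms

end Summit.ValiantsHypothesis.ValiantsHypothesis.Theorems.KPlusLogSqLaw.TowerGraft
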